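import Summits.BirchSwinnertonDyer.BirchSwinnertonDyer.Theorems.ByReductionTypeAtTwoFineSelmerConjAAtTwoAdditivePotGoodClassNumberOddCriterion
import Summits.BirchSwinnertonDyer.BirchSwinnertonDyer.Theorems.ByReductionTypeAtTwoFineSelmerConjAAtTwoAdditivePotGoodTwoLayerStampsEvenIndexD
import HarnessLib

/-!
# Route `ByReductionTypeAtTwo` (rung K4), crux C1″ `FineSelmerConjAAtTwoAdditivePotGood` (item stmt-BirchSwinnertonDyer-22615):
# ODD CLASS NUMBER (h = 3 IN THE CENSUS) FOR THE CUBIC FIELD OF DISCRIMINANT `−12936` (`X³ + (-1)X² + (-30)X + (78)`, index `1`) BY A NORM CERTIFICATE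
# (KERNEL) — the `2`-torsion point field `ℚ(P)` of the census row `413952bm1`, whose two-layer stamp thereby drops to ONE displayed bit
# (a `--supports 22615` file; seat `bsd-2adic-k4-w1` GEN 6; consumer of `…ClassNumberOneCriterion` / `…ClassNumberOneCriterionFrac`)

HONEST FRAMING (cell `bsd-2adic`, D-0036/D-0054): §1 UNCONDITIONAL kernel arithmetic; §2 conditional on `hLim2` (Lim 2017 Thm. 3.5 at `2`) BY NAME
and ONE displayed bit (`e₁ = 0`, i.e. `2 ∤ h(ℚ(θ, √2))`, census `cyc6 = []`); closes nothing at the `∀`-level; nothing booked; BSD is not proved by any of this.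

THE CERTIFICATE (generated by the seat's exact-arithmetic tools — reduced model, integral basis, relation sieve with Dedekind–Kummer
bookkeeping, unit reduction — and CHECKED HERE by the kernel): `g = X³ + (-1)X² + (-30)X + (78)`, `disc g = 12936 = 1² · (-12936)`;
`M_K < 33`.
For every prime `ℓ < 33` and every root `a` of `g mod ℓ` the proof lists a generator `(x + yθ + zθ²)/m` of the ideals `I ∋ ℓ, θ − a` of norm `ℓ`
(13 witnesses, 0 of them outside `ℤ[θ]`, 9 of them CUBE witnesses (I³ = (ω), with Bézout identity and lift)). No Dedekind–Kummer theory is invoked in the proof: the criterion only uses `𝓞/I ≅ 𝔽_ℓ`.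

References: [Marcus1977] Ch. 2 Exercise 27, Ch. 5 Thm. 35–37; [Cohen1993] §4.8.2, §6.3; [Lim2017FineSelmer] Thm. 3.5, Lemma 3.2;
[Greenberg2001IwasawaPastPresent] Prop. 2.1 (Iwasawa 1956); [Fukuda1994] Thm. 1 (1).
-/

set_option autoImplicit false
-- sibling precedent (`…ClassNumberOneCriterionFrac.lean`): the directory name repeats the summit name
set_option linter.dupNamespace false

noncomputable section

open scoped Classical IntermediateField NumberField Real nonZeroDivisors

namespace Summit.BirchSwinnertonDyer.BirchSwinnertonDyer.Theorems.AddKatoTwo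

open WeierstrassCurve Field Polynomial IsDedekindDomain NumberField Matrix Literature.NumberTheory.EllipticCurves
  Literature.NumberTheory.GaloisRepresentations
  Literature.NumberTheory.IwasawaTheory
  Summit.BirchSwinnertonDyer.BirchSwinnertonDyer.Theorems.AlignedTransportAtTwoTorsionPointField
  Summit.BirchSwinnertonDyer.BirchSwinnertonDyer.Theses.ByReductionTypeAtTwo

/-! ## §1 The certificate: `h` odd for the field of `X³ + (-1)X² + (-30)X + (78)` -/

section Certificate

variable (K : Type) [Field K] [NumberField K]

/-- **`h` is ODD for every cubic number field whose integers contain a root `θ` of `X³ + (-1)X² + (-30)X + (78)`** (`|disc| = 12936`, index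
`1`, `M_K < 33`): a norm certificate — for every prime `ℓ < 33` and every root `a` of the cubic mod `ℓ` a generator
of the CUBE (or of the ideal itself) `(x + yθ + zθ²)/m ∈ 𝓞 K` of every ideal `I ∋ ℓ, θ − a` of norm `ℓ` (listed in the proof; `m > 1` = element of `𝓞 K ∖ ℤ[θ]`, certified by its
scaled cubic identity). KERNEL.
[cite: Marcus1977, Ch. 5 Thm. 37 and Cor. 2] [cite: Cohen1993, §6.3] -/
theorem odd_classNumber_of_root_d12936n (h3 : Module.finrank ℚ K = 3) (b : 𝓞 K)
    (hb : b ^ 3 + (-1 : ℤ) * b ^ 2 + (-30 : ℤ) * b + (78 : ℤ) = 0) : Odd (NumberField.classNumber K) := by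
  have hirr := irreducible_cubic_d12936n
  have hd : |NumberField.discr K| ≤ (12936 : ℕ) :=
    (abs_discr_le_abs_cubic_discr K h3 b hirr hb).trans (by simp only [Cubic.discr]; norm_num)
  refine odd_classNumber_of_cubeCertificate K h3 (B := 33)
    (minkowskiBound_lt_of_sqrt_le K h3 hd (s := 113.74)
      ((Real.sqrt_le_sqrt (by norm_num : ((12936 : ℕ) : ℝ) ≤ (113.74 : ℝ) ^ 2)).trans (Real.sqrt_sq (by norm_num)).le)
      (by norm_num)) ?_
  intro ℓ hℓB hℓ J hJ
  interval_cases ℓ <;> norm_num at hℓ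
  · -- `ℓ = 2`: roots [0, 1]
    refine pow_three_eq_span_of_cert K h3 b hirr hb (by norm_num) (fun a ha hdvd => ?_) hJ
    interval_cases a <;> norm_num at hdvd
    · exact Or.inr ⟨74, (-6), (-3), 1, by norm_num, by norm_num, ⟨_, by rw [Nat.cast_one, one_mul]⟩, by norm_num,
        ⟨2, 1, 0, 0, 37, (-3), (-2), by push_cast; linear_combination ((0 : 𝓞 K)) * hb⟩, ⟨0, by norm_num⟩⟩
    · exact Or.inr ⟨(-5285), 2904, (-411), 1, by norm_num, by norm_num, ⟨_, by rw [Nat.cast_one, one_mul]⟩, by norm_num,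
        ⟨1, 1, 1, 0, 13387, (-7356), 1041, by push_cast; linear_combination ((-411 : 𝓞 K)) * hb⟩, ⟨1, by norm_num⟩⟩
  · -- `ℓ = 3`: roots [0, 1]
    refine pow_three_eq_span_of_cert K h3 b hirr hb (by norm_num) (fun a ha hdvd => ?_) hJ
    interval_cases a <;> norm_num at hdvd
    · exact Or.inr ⟨93, (-15), (-5), 1, by norm_num, by norm_num, ⟨_, by rw [Nat.cast_one, one_mul]⟩, by norm_num,
        ⟨2, 1, 0, 0, 31, (-5), (-2), by push_cast; linear_combination ((0 : 𝓞 K)) * hb⟩, ⟨0, by norm_num⟩⟩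
    · exact Or.inr ⟨(-9773), 5370, (-760), 1, by norm_num, by norm_num, ⟨_, by rw [Nat.cast_one, one_mul]⟩, by norm_num,
        ⟨1, 2, 1, 0, 13245, (-7278), 1030, by push_cast; linear_combination ((-760 : 𝓞 K)) * hb⟩, ⟨0, by norm_num⟩⟩
  · -- `ℓ = 5`: roots none
    refine pow_three_eq_span_of_cert K h3 b hirr hb (by norm_num) (fun a ha hdvd => ?_) hJ
    interval_cases a <;> norm_num at hdvd
  · -- `ℓ = 7`: roots [5]
    refine pow_three_eq_span_of_cert K h3 b hirr hb (by norm_num) (fun a ha hdvd => ?_) hJ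
    interval_cases a <;> norm_num at hdvd
    · exact Or.inr ⟨69895, (-7287), (-3101), 1, by norm_num, by norm_num, ⟨_, by rw [Nat.cast_one, one_mul]⟩, by norm_num,
        ⟨3, 0, 0, 0, 29, (-15), 2, by push_cast; linear_combination ((-1 : 𝓞 K)) * hb⟩, ⟨0, by norm_num⟩⟩
  · -- `ℓ = 11`: roots [2, 8]
    refine pow_three_eq_span_of_cert K h3 b hirr hb (by norm_num) (fun a ha hdvd => ?_) hJ
    interval_cases a <;> norm_num at hdvd
    · exact Or.inr ⟨(-5029), 2763, (-391), 1, by norm_num, by norm_num, ⟨_, by rw [Nat.cast_one, one_mul]⟩, by norm_num,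
        ⟨2, 9, 0, 0, (-4115), 2261, (-320), by push_cast; linear_combination ((0 : 𝓞 K)) * hb⟩, ⟨0, by norm_num⟩⟩
    · exact Or.inr ⟨(-109579), 8430, 4368, 1, by norm_num, by norm_num, ⟨_, by rw [Nat.cast_one, one_mul]⟩, by norm_num,
        ⟨1, 3, 6, 0, (-215723), 14005, 8172, by push_cast; linear_combination ((26208 : 𝓞 K)) * hb⟩, ⟨0, by norm_num⟩⟩
  · -- `ℓ = 13`: roots [0, 6, 8]
    refine pow_three_eq_span_of_cert K h3 b hirr hb (by norm_num) (fun a ha hdvd => ?_) hJ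
    interval_cases a <;> norm_num at hdvd
    · exact Or.inl ⟨(-13), 7, (-1), 1, by norm_num, by norm_num, ⟨_, by rw [Nat.cast_one, one_mul]⟩, by norm_num⟩
    · exact Or.inl ⟨25, (-14), 2, 1, by norm_num, by norm_num, ⟨_, by rw [Nat.cast_one, one_mul]⟩, by norm_num⟩
    · exact Or.inl ⟨17, 21, 3, 1, by norm_num, by norm_num, ⟨_, by rw [Nat.cast_one, one_mul]⟩, by norm_num⟩
  · -- `ℓ = 17`: roots none
    refine pow_three_eq_span_of_cert K h3 b hirr hb (by norm_num) (fun a ha hdvd => ?_) hJ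
    interval_cases a <;> norm_num at hdvd
  · -- `ℓ = 19`: roots [9]
    refine pow_three_eq_span_of_cert K h3 b hirr hb (by norm_num) (fun a ha hdvd => ?_) hJ
    interval_cases a <;> norm_num at hdvd
    · exact Or.inr ⟨(-183815146745), 101001908055, (-14294575391), 1, by norm_num, by norm_num, ⟨_, by rw [Nat.cast_one, one_mul]⟩, by norm_num,
        ⟨1, 13, 16, 0, 813159641068, (-446811248994), 63236202239, by push_cast; linear_combination ((-228713206256 : 𝓞 K)) * hb⟩, ⟨0, by norm_num⟩⟩
  · -- `ℓ = 23`: roots none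
    refine pow_three_eq_span_of_cert K h3 b hirr hb (by norm_num) (fun a ha hdvd => ?_) hJ
    interval_cases a <;> norm_num at hdvd
  · -- `ℓ = 29`: roots [18]
    refine pow_three_eq_span_of_cert K h3 b hirr hb (by norm_num) (fun a ha hdvd => ?_) hJ
    interval_cases a <;> norm_num at hdvd
    · exact Or.inl ⟨7, (-2), 0, 1, by norm_num, by norm_num, ⟨_, by rw [Nat.cast_one, one_mul]⟩, by norm_num⟩
  · -- `ℓ = 31`: roots [12]
    refine pow_three_eq_span_of_cert K h3 b hirr hb (by norm_num) (fun a ha hdvd => ?_) hJ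
    interval_cases a <;> norm_num at hdvd
    · exact Or.inr ⟨(-164453), 149529, 29121, 1, by norm_num, by norm_num, ⟨_, by rw [Nat.cast_one, one_mul]⟩, by norm_num,
        ⟨1, 9, 5, 0, (-414105), 157795, 37269, by push_cast; linear_combination ((145605 : 𝓞 K)) * hb⟩, ⟨0, by norm_num⟩⟩

end Certificate

/-! ## §2 The census row `413952bm1` -/

/-- **(A)₂ for `413952bm1` from ONE parity bit** (was: two bits, `conjA_two_413952bm1_of_twoBits`): the parity of `h(ℚ(θ))` is now KERNEL
(`h` odd, census `h = 3`: `odd_classNumber_of_root_d12936n`), so only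
«`e_1 = 0` along the cyclotomic `ℤ₂`-extensions of `ℚ(θ)`» = `2 ∤ h(ℚ(θ, √2))` (census `cyc6 = []`) stays displayed; granted `hLim2` BY NAME.
`θ` is any root of `X³ + (-1)X² + (-30)X + (78)`. [cite: Lim2017FineSelmer, §3 Thm. 3.5 and Lemma 3.2] [cite: Fukuda1994, Thm. 1 (1), p. 264]
[cite: Cohen1993, §6.3] -/
theorem conjA_two_413952bm1_of_layerOneBit
    (hLim2 : Lim2017.thm35_at_two_fineSelmerDual_moduleFinite_of_classicalMuVanishes_of_le_divisionField_four)
    {θ : AlgebraicClosure ℚ} (hθ : aeval θ (Cubic.toPoly ⟨1, ((-1 : ℤ) : ℚ), ((-30 : ℤ) : ℚ), ((78 : ℤ) : ℚ)⟩) = 0)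
    (h1 : haveI : FiniteDimensional ℚ (IntermediateField.adjoin ℚ {θ}) :=
        IntermediateField.adjoin.finiteDimensional ((AlgebraicClosure.isAlgebraic ℚ).isAlgebraic θ).isIntegral
      haveI : NumberField (IntermediateField.adjoin ℚ {θ}) := NumberField.mk
      ∀ κL : ZpExtension (IntermediateField.adjoin ℚ {θ}) 2, κL.IsCyclotomic → classNumberPExp κL 1 = 0)
    (κ : ZpExtension ℚ 2) (hκ : κ.IsCyclotomic) :
    haveI := isElliptic_413952bm1'
    ∃ (γ : absoluteGaloisGroup ℚ) (D : (⟨0, ((-1 : ℤ) : ℚ), 0, ((-134300735 : ℤ) : ℚ), ((-599008857117 : ℤ) : ℚ)⟩ : WeierstrassCurve ℚ).FineSelmerDualData κ γ),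
      Module.Finite ℤ_[2] (RestrictScalars ℤ_[2] (IwasawaAlgebra 2) D.X) := by
  haveI := isElliptic_413952bm1'
  exact conjA_two_413952bm1_of_twoBits hLim2 hθ
    (not_two_dvd_card_classGroup_adjoin_of_forall_cubicField_odd irreducible_cubic_d12936n (odd_classNumber_of_root_d12936n) hθ) h1 κ hκ

end Summit.BirchSwinnertonDyer.BirchSwinnertonDyer.Theorems.AddKatoTwo

end
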